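import Mathlib
import HarnessLib
import Summits.HubbardSuperconductivity.HubbardSuperconductivity.Theorems.ThermalWedgeTwTipContinuationCrossRoute
import Summits.HubbardSuperconductivity.HubbardSuperconductivity.Theorems.ChiralWindowCwThesisChannelInfNonpos
import Summits.HubbardSuperconductivity.HubbardSuperconductivity.Theorems.ChiralWindowCwThesisHalfFilling
import Summits.HubbardSuperconductivity.HubbardSuperconductivity.Theorems.ChiralWindowDefsResidual
import Summits.HubbardSuperconductivity.HubbardSuperconductivity.Theorems.ThermalWedgeTwTipContinuationB1gPointReduction
import Summits.HubbardSuperconductivity.HubbardSuperconductivity.Theorems.ThermalWedgeTwTipContinuationB1gFilling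
import Summits.HubbardSuperconductivity.HubbardSuperconductivity.Theorems.ThermalWedgeTwTipContinuationB1gPointSound
import Summits.HubbardSuperconductivity.HubbardSuperconductivity.Theorems.ThermalWedgeTwTipContinuationB1gRecordDefs2

/-!
# `TwTipContinuation` (stmt-HubbardSuperconductivity-1700), line `kl-mechanism-datum`: THE LINE AS ONE CONDITIONAL THEOREM — conservative record no. 2

Assembly (pure logic over landed pieces) of the `B₁g`-point certificate at `μ₀ = -7/10`, read on the CONSERVATIVE second record
`klB1gBox22` (`…B1gRecordDefs2.lean`: `N = 128` design, square-mass widths doubled; the twin file `…B1gPoint.lean` does the same for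
the first record `klB1gBox2`, p139987):

* `stub_b1gRecord_of_enclosures2` — the skeleton's record stub from the residual numerical hypothesis alone: the concrete record
  `(klB1gBox2, klB1gTab2, klB1gGamma2)` (`Theorems/…B1gRecordDefs.lean`, p141167) passes its nine kernel-decided checks;
* `b1gLeadsAtPoint_of_enclosures2` — `U = 1` leadership of `B₁g` by `γ = 21/2000` at `μ₀` (soundness `stub_b1gPointSound`, p138724);
* `b1gLeadsInWindow_of_enclosures2` — the in-window Kohn–Luttinger datum (statement of the line's registered stub
  `stub_b1gLeadsInWindow`; point reduction `stub_b1gPointReduction` p138028 with the filling bounds `stub_b1gFilling` p138479);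
* `certB1gWedge_of_enclosures2` — its two-clause form (window form of `TorusCooperLog.CertB1g` stmt-2682 / split child `TwCertB1gWedge`);
* `twTipContinuation_of_klCanonical_of_b1gEnclosures2` — the crux from the shared mechanism `TorusCooperLog.KLCanonical` (stmt-2681,
  the line's held stub) and the eight residual-form enclosures of the record, through `CrossRoute.twTipContinuation_of_klCanonical` (p92871).

So the crux `TwTipContinuation` now rests, in the tree, on exactly two named open pieces: the open problem `KLCanonical` and the
certified-numerics debt `∀ χ, (klB1gBox2.blk χ).EnclosureR klB1gTab2 (-7/10) χ` (design and targets: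
`Cruxes/TwTipContinuation/B1gRecordDesign.md`).  Kohn–Luttinger 1965; Raghu–Kivelson–Scalapino PRB 81 (2010) 224505 §III.
-/

noncomputable section

namespace Summit.HubbardSuperconductivity.TwTipContinuation.KlMechanismDatum

open MeasureTheory Literature.MathematicalPhysics.QuantumLattice
open Summit.HubbardSuperconductivity.HubbardSuperconductivity.Theorems
open Summit.HubbardSuperconductivity.HubbardSuperconductivity.Theorems.CwKLChiralWindow

/-- **The registered record stub from the enclosures alone** (`stub_b1gRecord_of_enclosures2`): the concrete record
`(klB1gBox2, klB1gTab2, klB1gGamma2)` passes the nine kernel-decided checks (`klB1g2_*`, `Theorems/…B1gRecordDefs.lean`), so the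
statement of the skeleton's stub `stub_b1gRecord` holds as soon as the residual-form enclosures of its five blocks hold at
`μ₀ = -7/10`. [folklore] -/
theorem stub_b1gRecord_of_enclosures2
    (hE : ∀ χ : D4Irrep, (klB1gBox2.blk χ).EnclosureR klB1gTab2 ((klB1gBox2.mulo : ℚ) : ℝ) χ) :
    ∃ (bx : KLBox) (tab : List KLTrig) (γ : ℚ), 0 < γ ∧ bx.mulo = -7 / 10 ∧
    bx.bB1g.templeOKR tab D4Irrep.B1g = true ∧ bx.bB1g.withU = false ∧
    bx.bA1g.lowerOKR tab D4Irrep.A1g = true ∧ bx.bA2g.lowerOKR tab D4Irrep.A2g = true ∧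
    bx.bB2g.lowerOKR tab D4Irrep.B2g = true ∧ bx.bE.lowerOKR tab D4Irrep.E = true ∧
    bx.b1gLeadsOKR tab γ = true ∧
    (∀ χ : D4Irrep, (bx.blk χ).EnclosureR tab ((bx.mulo : ℚ) : ℝ) χ) :=
  ⟨klB1gBox2, klB1gTab2, klB1gGamma2, klB1g2_gamma_pos, klB1g2_mulo, klB1g2_templeOKR, klB1g2_withU, klB1g2_lowerOKR_A1g,
    klB1g2_lowerOKR_A2g, klB1g2_lowerOKR_B2g, klB1g2_lowerOKR_E, klB1g2_b1gLeadsOKR, hE⟩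

/-- **`U = 1` leadership of `B₁g` at `μ₀ = -7/10` from the enclosures** (soundness `stub_b1gPointSound`, p138724). [folklore] -/
theorem b1gLeadsAtPoint_of_enclosures2
    (hE : ∀ χ : D4Irrep, (klB1gBox2.blk χ).EnclosureR klB1gTab2 ((klB1gBox2.mulo : ℚ) : ℝ) χ) :
    ∀ χ : D4Irrep, χ ≠ D4Irrep.B1g →
      channelInf (squareDispersion 1 0) (-7 / 10) 1 D4Irrep.B1g + ((klB1gGamma2 : ℚ) : ℝ) ≤
        channelInf (squareDispersion 1 0) (-7 / 10) 1 χ := by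
  have h := stub_b1gPointSound klB1gBox2 klB1gTab2 klB1gGamma2 (by rw [klB1g2_mulo]; norm_num) (by rw [klB1g2_mulo]; norm_num)
    klB1g2_templeOKR klB1g2_withU klB1g2_lowerOKR_A1g klB1g2_lowerOKR_A2g klB1g2_lowerOKR_B2g klB1g2_lowerOKR_E klB1g2_b1gLeadsOKR hE
  have hμ : ((klB1gBox2.mulo : ℚ) : ℝ) = -7 / 10 := by rw [klB1g2_mulo]; push_cast; ring
  rwa [hμ] at h

/-- **The in-window Kohn–Luttinger `B₁g` datum from the enclosures** (the statement of the line's registered stub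
`stub_b1gLeadsInWindow` / child `TwCertB1gWedge` in leadership-only form): point reduction `stub_b1gPointReduction` (p138028) at
`μ₀ = -7/10` with the filling bounds `stub_b1gFilling` (p138479). [cite: RaghuKivelsonScalapino2010, §III Fig. 2] -/
theorem b1gLeadsInWindow_of_enclosures2
    (hE : ∀ χ : D4Irrep, (klB1gBox2.blk χ).EnclosureR klB1gTab2 ((klB1gBox2.mulo : ℚ) : ℝ) χ) :
    ∃ δ ∈ Set.Icc (1 / 10 : ℝ) (2 / 5), ∃ γ U₁ : ℝ, 0 < γ ∧ 0 < U₁ ∧ ∀ U ∈ Set.Ioo (0:ℝ) U₁,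
      ∀ χ : D4Irrep, χ ≠ D4Irrep.B1g →
        channelInf (squareDispersion 1 0) (chemicalPotentialOfDensity (squareDispersion 1 0) (1 - δ)) U
            D4Irrep.B1g + γ * U ^ 2 ≤
          channelInf (squareDispersion 1 0) (chemicalPotentialOfDensity (squareDispersion 1 0) (1 - δ)) U χ :=
  stub_b1gPointReduction (-7 / 10) klB1gGamma2 (by norm_num) (by norm_num) (by exact_mod_cast klB1g2_gamma_pos)
    stub_b1gFilling.1 stub_b1gFilling.2 (b1gLeadsAtPoint_of_enclosures2 hE)

/-- **The two-clause in-window datum** (signature of `TorusCooperLog.CertB1g`'s window form / the moot stmt-15257 / split child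
`TwCertB1gWedge`) from the enclosures: attractiveness `channelInf B1g ≤ -γU²` follows from leadership over `A₂g` and the landed
non-positivity of channel bottoms (`CwThesis.stub_channelInfNonpos`, `CwThesis.chemicalPotentialOfDensity_doping_mem_Ioo`).
[folklore] -/
theorem certB1gWedge_of_enclosures2
    (hE : ∀ χ : D4Irrep, (klB1gBox2.blk χ).EnclosureR klB1gTab2 ((klB1gBox2.mulo : ℚ) : ℝ) χ) :
    ∃ δ ∈ Set.Icc (1 / 10 : ℝ) (2 / 5), ∃ γ U₁ : ℝ, 0 < γ ∧ 0 < U₁ ∧ ∀ U ∈ Set.Ioo (0:ℝ) U₁,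
      channelInf (squareDispersion 1 0) (chemicalPotentialOfDensity (squareDispersion 1 0) (1 - δ)) U D4Irrep.B1g ≤ -(γ * U ^ 2) ∧
      ∀ χ : D4Irrep, χ ≠ D4Irrep.B1g →
        channelInf (squareDispersion 1 0) (chemicalPotentialOfDensity (squareDispersion 1 0) (1 - δ)) U D4Irrep.B1g + γ * U ^ 2 ≤
          channelInf (squareDispersion 1 0) (chemicalPotentialOfDensity (squareDispersion 1 0) (1 - δ)) U χ := by
  obtain ⟨δ, hδ, γ, U₁, hγ, hU₁, hlead⟩ := b1gLeadsInWindow_of_enclosures2 hE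
  refine ⟨δ, hδ, γ, U₁, hγ, hU₁, fun U hU => ⟨?_, hlead U hU⟩⟩
  have hδ' : δ ∈ Set.Ioo (0 : ℝ) 1 := ⟨by linarith [hδ.1], by linarith [hδ.2]⟩
  have hμ := Summit.HubbardSuperconductivity.HubbardSuperconductivity.Theorems.CwThesis.chemicalPotentialOfDensity_doping_mem_Ioo hδ'
  have hA2g : D4Irrep.A2g ≠ D4Irrep.B1g := by decide
  have h1 := hlead U hU D4Irrep.A2g hA2g
  have h2 := Summit.HubbardSuperconductivity.HubbardSuperconductivity.Theorems.CwThesis.stub_channelInfNonpos U D4Irrep.A2g hμ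
  linarith

/-- **The whole line as one conditional theorem of the tree.**  `TwTipContinuation` (stmt-1700) follows from the shared mechanism
`TorusCooperLog.KLCanonical` (stmt-2681, the held stub `stub_klCanonical`) and the eight residual-form enclosures of the `B₁g`-point
record at `μ₀ = -7/10` (the certified computation), through the landed door `CrossRoute.twTipContinuation_of_klCanonical` (p92871).
[folklore] -/
theorem twTipContinuation_of_klCanonical_of_b1gEnclosures2
    (hKL : Summit.HubbardSuperconductivity.HubbardSuperconductivity.Theses.TorusCooperLog.KLCanonical)
    (hE : ∀ χ : D4Irrep, (klB1gBox2.blk χ).EnclosureR klB1gTab2 ((klB1gBox2.mulo : ℚ) : ℝ) χ) :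
    Summit.HubbardSuperconductivity.HubbardSuperconductivity.Theses.ThermalWedge.TwTipContinuation :=
  Summit.HubbardSuperconductivity.TwTipContinuation.CrossRoute.twTipContinuation_of_klCanonical hKL (certB1gWedge_of_enclosures2 hE)

end Summit.HubbardSuperconductivity.TwTipContinuation.KlMechanismDatum

end
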